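import Summits.ResolutionOfSingularities.ResolutionOfSingularities.Theorems.EquisingularLiftEquisingularLiftNatResidualCut
import Literature.AlgebraicGeometry.Resolution.PermissibleCentres
import Mathlib.AlgebraicGeometry.Morphisms.Smooth
import Summits.ResolutionOfSingularities.ResolutionOfSingularities.Theorems.EquisingularLiftEquisingularLiftNatSmoothModelEnd
import HarnessLib

/-!
# [OURS · L1 W4.5(b) · EL♮] T-PERM VOCABULARY — the UPSTAIRS (lifted-model) frame of the crux `EquisingularLiftNat`
# (stmt-ResolutionOfSingularities-20038), any `n`: `ModelChainAt` (host rung), `PermAt` (strategist's S⁺), `PermELNat`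

Everything here is OURS (cell res-hironaka, crux chain w45b, slot W4.5(b)); NOT a statement of any manuscript; replaces the role of
NOTHING in the manuscript; AI-written, AI review is weaker than expert review. `--supports stmt-ResolutionOfSingularities-20038 --as
helper`. Typed from the CRUX-STRATEGIST's sketch (res-L1-w45b-strat-1 gen 5, STRATEGY-CENSUS v5 §Strengthen/§Transfer, `Sketch-perm.lean`
sha16 f2833a921cca68b2, evidence #45/#46 on stmt-20038; OFFER «landable by a pool seat … lead's call»; CHAIN w45b v7.6 records the frame),
landed by res-L1-w45b-lead-1 (parent-side, any-n host rung; TAKING 10:17:34Z). The TRANSFER to the crux is proved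
below; its one geometric input `SmoothModelEnd` is the theorem `…NatSmoothModelEnd.smoothModelEnd` (p523348).

THE FRAME. The route's original bet («lift to characteristic zero, resolve there, descend») read at the level of the chain: every stage
`(X′, σ′, Y′)` of the item's closure carries an `O`-FLAT closed subscheme `V(D′) ⊆ X′` (the LIFTED MODEL) whose special-fibre SET is the
strict-transform set `Y′`; each centre `C` (regular, `O`-flat, off the generic points of `Y`) lies INSIDE the model (`D′ ≤ C`); the
chain ENDS when the model is SMOOTH over `O`. The item's E1 clause is then AUTOMATIC (`supp C ⊆ supp D′`, `supp D′ ∩ F = Y′`).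

* `ModelChainAt p k n H ι` — THE HOST RUNG: the lifted-model chain as above (no permissibility asked). `ModelChainAt ⟹ HorizAt ⟹
  ELNatAt` for every `n` (`horizAt_of_modelChainAt`, `elNatAt_of_modelChainAt`: logic + `support_antitone` + `smoothModelEnd` +
  `elNatAt_of_horizAt` p508745); `horizAt_of_permAt`, `elNatAt_of_permAt`; `equisingularLiftNat_of_permELNat p`;
  **`permTransfer : (∀ p, PermELNat p) → EquisingularLiftNat`** (crux BY NAME).
* `PermAt p k n H ι` — the strategist's S⁺ (census object «PermAt», VERBATIM from the sketch): `ModelChainAt` with each centre moreover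
  CJS-PERMISSIBLE for the model (`Literature…IdealSheafData.IsPermissible (C.comap D′.subschemeι)`: `V(C)` regular, `V(D′)` normally flat
  along `V(C)`, no component — Cossart–Jannsen–Saito LNM 2270 Def. 3.1, tree `…Resolution/PermissibleCentres`). `PermAt ⟹ ModelChainAt`.
* `PermELNat p` — `PermAt` behind the `H`-binders of the crux at `p` (shape of `Theorems.EquisingularLiftNat p`).

WHY ONLY A CENSUS ENTRY / HOST RUNG (strat-1 v5, no leverage short of the summit): the existence half of `PermAt` for `n ≥ 5` asks for an
EQUIRESOLVABLE characteristic-0 lift of a 4-fold hypersurface singularity; for `n = 2` the crux closes WITHOUT models (p498502) while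
`PermAt(2)` needs singular equimultiple models. Vacuity / strength: `ModelChainAt` holds with the EMPTY chain whenever `H` has a SMOOTH lift
`V(D₀) ⊆ ℙⁿ_O` (e.g. `H` regular: p498240's rung), so it is satisfiable; it implies the crux's conclusion block, so it is not trivially true.
-/

set_option linter.dupNamespace false -- mandated namespace `Summit.<Summit>.<Problem>` of this single-conjunct summit

noncomputable section

open CategoryTheory AlgebraicGeometry TopologicalSpace
open Summit.ResolutionOfSingularities.ResolutionOfSingularities.Theorems.EquisingularLiftNatResidualCut
open Summit.ResolutionOfSingularities.ResolutionOfSingularities.Theorems.EquisingularLift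

namespace Summit.ResolutionOfSingularities.ResolutionOfSingularities.Cruxes.EquisingularLiftNat.PermFrame

/-- [OURS · HOST RUNG] **`ModelChainAt p k n H ι`** — a characteristic-0 DVR `O` with a surjection `π : O → k` such that for every
graded `φ` inducing `MvPolynomial.map π` and `Y = range (ι ≫ Proj.map φ)` some `(P′, σ, S′, D′)` lies in the closure of the stages
`(ℙⁿ_O, 𝟙, Y, D₀)` — `D₀` ANY ideal sheaf with `V(D₀)` flat over `O` and special-fibre set `Y` (a lift of `H`) — under the steps: blow up
a centre `C` with `V(C)` regular and `O`-flat, over non-generic points of `Y`, INSIDE the current model (`D′ ≤ C`), and carry to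
`X″ = Bl_C X′` any ideal sheaf `D″` with `V(D″)` flat over `O` and special-fibre set the new strict-transform set; and at the end
`V(D′) → Spec O` is SMOOTH. No E1 clause: it is implied (`…NatPermFrame.horizAt_of_modelChainAt`). (= the strategist's `PermAt` with the
permissibility clause removed — that clause is not used by the transfer.) [folklore] -/
def ModelChainAt (p : ℕ) (k : Type) [Field k] [CharP k p] [IsAlgClosed k] (n : ℕ) (H : AlgebraicGeometry.Scheme.{0})
    (ι : H ⟶ (Literature.AlgebraicGeometry.Motives.projectiveSpace n k).left) : Prop :=
  ∃ (O : Type) (_ : CommRing O) (_ : IsDomain O) (_ : IsDiscreteValuationRing O) (_ : CharZero O) (π : O →+* k),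
    Function.Surjective π ∧ (letI := MvPolynomial.gradedAlgebra (σ := Fin (n + 1)) (R := O);
      letI := MvPolynomial.gradedAlgebra (σ := Fin (n + 1)) (R := k);
      ∀ (φ : MvPolynomial.homogeneousSubmodule (Fin (n + 1)) O →+*ᵍ MvPolynomial.homogeneousSubmodule (Fin (n + 1)) k)
        (hφ' : HomogeneousIdeal.irrelevant (MvPolynomial.homogeneousSubmodule (Fin (n + 1)) k) ≤
          (HomogeneousIdeal.irrelevant (MvPolynomial.homogeneousSubmodule (Fin (n + 1)) O)).map φ),
        (∀ s, φ s = MvPolynomial.map π s) →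
        ∀ Y : Set (Proj (MvPolynomial.homogeneousSubmodule (Fin (n + 1)) O)),
          Y = Set.range (CategoryStruct.comp ι (Proj.map φ hφ') :
            H ⟶ Proj (MvPolynomial.homogeneousSubmodule (Fin (n + 1)) O)) →
          ∃ (P' : Scheme.{0}) (σ : P' ⟶ Proj (MvPolynomial.homogeneousSubmodule (Fin (n + 1)) O)) (S' : Set P')
            (D' : P'.IdealSheafData),
            (∀ Q : (∀ X' : Scheme.{0}, (X' ⟶ Proj (MvPolynomial.homogeneousSubmodule (Fin (n + 1)) O)) → Set X' →
                X'.IdealSheafData → Prop),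
              (∀ D₀ : (Proj (MvPolynomial.homogeneousSubmodule (Fin (n + 1)) O)).IdealSheafData,
                  Flat (CategoryStruct.comp D₀.subschemeι
                    (CategoryStruct.comp (Proj.toSpecZero (MvPolynomial.homogeneousSubmodule (Fin (n + 1)) O))
                      (Spec.map (CommRingCat.ofHom (algebraMap O (MvPolynomial.homogeneousSubmodule (Fin (n + 1)) O 0)))))) →
                  (D₀.support : Set (Proj (MvPolynomial.homogeneousSubmodule (Fin (n + 1)) O))) ∩
                      (CategoryStruct.comp (Proj.toSpecZero (MvPolynomial.homogeneousSubmodule (Fin (n + 1)) O))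
                        (Spec.map (CommRingCat.ofHom (algebraMap O (MvPolynomial.homogeneousSubmodule (Fin (n + 1)) O 0))))) ⁻¹'
                        {IsLocalRing.closedPoint O} = Y →
                  Q (Proj (MvPolynomial.homogeneousSubmodule (Fin (n + 1)) O)) (CategoryStruct.id _) Y D₀) →
              (∀ (X' X'' : Scheme.{0}) (σ' : X' ⟶ Proj (MvPolynomial.homogeneousSubmodule (Fin (n + 1)) O)) (Y' : Set X')
                  (D' : X'.IdealSheafData) (C : X'.IdealSheafData) (τ : X'' ⟶ X') (D'' : X''.IdealSheafData),
                  Q X' σ' Y' D' → Literature.AlgebraicGeometry.Resolution.IsBlowup τ C →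
                  Literature.AlgebraicGeometry.Resolution.Scheme.IsRegular C.subscheme →
                  Flat (CategoryStruct.comp C.subschemeι (CategoryStruct.comp σ'
                    (CategoryStruct.comp (Proj.toSpecZero (MvPolynomial.homogeneousSubmodule (Fin (n + 1)) O))
                      (Spec.map (CommRingCat.ofHom (algebraMap O (MvPolynomial.homogeneousSubmodule (Fin (n + 1)) O 0))))))) →
                  σ' '' (C.support : Set X') ⊆ {x | ¬ IsGenericPoint x Y} →
                  D' ≤ C →
                  Flat (CategoryStruct.comp D''.subschemeι (CategoryStruct.comp (CategoryStruct.comp τ σ')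
                    (CategoryStruct.comp (Proj.toSpecZero (MvPolynomial.homogeneousSubmodule (Fin (n + 1)) O))
                      (Spec.map (CommRingCat.ofHom (algebraMap O (MvPolynomial.homogeneousSubmodule (Fin (n + 1)) O 0))))))) →
                  (D''.support : Set X'') ∩ (CategoryStruct.comp (CategoryStruct.comp τ σ')
                    (CategoryStruct.comp (Proj.toSpecZero (MvPolynomial.homogeneousSubmodule (Fin (n + 1)) O))
                      (Spec.map (CommRingCat.ofHom (algebraMap O (MvPolynomial.homogeneousSubmodule (Fin (n + 1)) O 0)))))) ⁻¹'
                      {IsLocalRing.closedPoint O} = closure (τ ⁻¹' (Y' \ (C.support : Set X'))) →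
                  Q X'' (CategoryStruct.comp τ σ') (closure (τ ⁻¹' (Y' \ (C.support : Set X')))) D'') →
              Q P' σ S' D') ∧
            Smooth (CategoryStruct.comp D'.subschemeι (CategoryStruct.comp σ
              (CategoryStruct.comp (Proj.toSpecZero (MvPolynomial.homogeneousSubmodule (Fin (n + 1)) O))
                (Spec.map (CommRingCat.ofHom (algebraMap O (MvPolynomial.homogeneousSubmodule (Fin (n + 1)) O 0))))))))

/-- [OURS · STRATEGIST S⁺] **`PermAt p k n H ι`** (res-L1-w45b-strat-1, `Sketch-perm.lean` f2833a921cca68b2, VERBATIM): `ModelChainAt` with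
each centre moreover CJS-PERMISSIBLE for the current model: `IsPermissible (C.comap D′.subschemeι)` (Cossart–Jannsen–Saito LNM 2270 Def. 3.1;
tree `Literature/AlgebraicGeometry/Resolution/PermissibleCentres.lean`). [folklore] -/
def PermAt (p : ℕ) (k : Type) [Field k] [CharP k p] [IsAlgClosed k] (n : ℕ) (H : AlgebraicGeometry.Scheme.{0})
    (ι : H ⟶ (Literature.AlgebraicGeometry.Motives.projectiveSpace n k).left) : Prop :=
  ∃ (O : Type) (_ : CommRing O) (_ : IsDomain O) (_ : IsDiscreteValuationRing O) (_ : CharZero O) (π : O →+* k),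
    Function.Surjective π ∧ (letI := MvPolynomial.gradedAlgebra (σ := Fin (n + 1)) (R := O);
      letI := MvPolynomial.gradedAlgebra (σ := Fin (n + 1)) (R := k);
      ∀ (φ : MvPolynomial.homogeneousSubmodule (Fin (n + 1)) O →+*ᵍ MvPolynomial.homogeneousSubmodule (Fin (n + 1)) k)
        (hφ' : HomogeneousIdeal.irrelevant (MvPolynomial.homogeneousSubmodule (Fin (n + 1)) k) ≤
          (HomogeneousIdeal.irrelevant (MvPolynomial.homogeneousSubmodule (Fin (n + 1)) O)).map φ),
        (∀ s, φ s = MvPolynomial.map π s) →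
        ∀ Y : Set (Proj (MvPolynomial.homogeneousSubmodule (Fin (n + 1)) O)),
          Y = Set.range (CategoryStruct.comp ι (Proj.map φ hφ') :
            H ⟶ Proj (MvPolynomial.homogeneousSubmodule (Fin (n + 1)) O)) →
          ∃ (P' : Scheme.{0}) (σ : P' ⟶ Proj (MvPolynomial.homogeneousSubmodule (Fin (n + 1)) O)) (S' : Set P')
            (D' : P'.IdealSheafData),
            (∀ Q : (∀ X' : Scheme.{0}, (X' ⟶ Proj (MvPolynomial.homogeneousSubmodule (Fin (n + 1)) O)) → Set X' →
                X'.IdealSheafData → Prop),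
              (∀ D₀ : (Proj (MvPolynomial.homogeneousSubmodule (Fin (n + 1)) O)).IdealSheafData,
                  Flat (CategoryStruct.comp D₀.subschemeι
                    (CategoryStruct.comp (Proj.toSpecZero (MvPolynomial.homogeneousSubmodule (Fin (n + 1)) O))
                      (Spec.map (CommRingCat.ofHom (algebraMap O (MvPolynomial.homogeneousSubmodule (Fin (n + 1)) O 0)))))) →
                  (D₀.support : Set (Proj (MvPolynomial.homogeneousSubmodule (Fin (n + 1)) O))) ∩
                      (CategoryStruct.comp (Proj.toSpecZero (MvPolynomial.homogeneousSubmodule (Fin (n + 1)) O))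
                        (Spec.map (CommRingCat.ofHom (algebraMap O (MvPolynomial.homogeneousSubmodule (Fin (n + 1)) O 0))))) ⁻¹'
                        {IsLocalRing.closedPoint O} = Y →
                  Q (Proj (MvPolynomial.homogeneousSubmodule (Fin (n + 1)) O)) (CategoryStruct.id _) Y D₀) →
              (∀ (X' X'' : Scheme.{0}) (σ' : X' ⟶ Proj (MvPolynomial.homogeneousSubmodule (Fin (n + 1)) O)) (Y' : Set X')
                  (D' : X'.IdealSheafData) (C : X'.IdealSheafData) (τ : X'' ⟶ X') (D'' : X''.IdealSheafData),
                  Q X' σ' Y' D' → Literature.AlgebraicGeometry.Resolution.IsBlowup τ C →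
                  Literature.AlgebraicGeometry.Resolution.Scheme.IsRegular C.subscheme →
                  Flat (CategoryStruct.comp C.subschemeι (CategoryStruct.comp σ'
                    (CategoryStruct.comp (Proj.toSpecZero (MvPolynomial.homogeneousSubmodule (Fin (n + 1)) O))
                      (Spec.map (CommRingCat.ofHom (algebraMap O (MvPolynomial.homogeneousSubmodule (Fin (n + 1)) O 0))))))) →
                  σ' '' (C.support : Set X') ⊆ {x | ¬ IsGenericPoint x Y} →
                  D' ≤ C →
                  Literature.AlgebraicGeometry.Resolution.IdealSheafData.IsPermissible (C.comap D'.subschemeι) →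
                  Flat (CategoryStruct.comp D''.subschemeι (CategoryStruct.comp (CategoryStruct.comp τ σ')
                    (CategoryStruct.comp (Proj.toSpecZero (MvPolynomial.homogeneousSubmodule (Fin (n + 1)) O))
                      (Spec.map (CommRingCat.ofHom (algebraMap O (MvPolynomial.homogeneousSubmodule (Fin (n + 1)) O 0))))))) →
                  (D''.support : Set X'') ∩ (CategoryStruct.comp (CategoryStruct.comp τ σ')
                    (CategoryStruct.comp (Proj.toSpecZero (MvPolynomial.homogeneousSubmodule (Fin (n + 1)) O))
                      (Spec.map (CommRingCat.ofHom (algebraMap O (MvPolynomial.homogeneousSubmodule (Fin (n + 1)) O 0)))))) ⁻¹'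
                      {IsLocalRing.closedPoint O} = closure (τ ⁻¹' (Y' \ (C.support : Set X'))) →
                  Q X'' (CategoryStruct.comp τ σ') (closure (τ ⁻¹' (Y' \ (C.support : Set X')))) D'') →
              Q P' σ S' D') ∧
            Smooth (CategoryStruct.comp D'.subschemeι (CategoryStruct.comp σ
              (CategoryStruct.comp (Proj.toSpecZero (MvPolynomial.homogeneousSubmodule (Fin (n + 1)) O))
                (Spec.map (CommRingCat.ofHom (algebraMap O (MvPolynomial.homogeneousSubmodule (Fin (n + 1)) O 0))))))))

/-- [OURS · STRATEGIST S⁺, item spelling] **`PermELNat p`** — `PermAt` behind the `H`-binders of the crux at the prime `p` (shape of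
`Theorems.EquisingularLiftNat p`: `p` prime, `k` algebraically closed of characteristic `p`, `H ⊆ ℙⁿ_k` an integral hypersurface). [folklore] -/
def PermELNat (p : ℕ) : Prop :=
  p.Prime → ∀ (k : Type) [Field k] [CharP k p] [IsAlgClosed k] (n : ℕ) (H : AlgebraicGeometry.Scheme.{0})
    (ι : H ⟶ (Literature.AlgebraicGeometry.Motives.projectiveSpace n k).left),
    AlgebraicGeometry.IsClosedImmersion ι → AlgebraicGeometry.IsIntegral H →
    (∀ y : (Literature.AlgebraicGeometry.Motives.projectiveSpace n k).left,
      ∃ U : (Literature.AlgebraicGeometry.Motives.projectiveSpace n k).left.affineOpens,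
        y ∈ (U : (Literature.AlgebraicGeometry.Motives.projectiveSpace n k).left.Opens) ∧ (ι.ker.ideal U).IsPrincipal) →
    PermAt p k n H ι

/-- `PermAt ⟹ ModelChainAt`: a closure under MORE step hypotheses lies in the closure under fewer. [folklore] -/
theorem modelChainAt_of_permAt (p : ℕ) (k : Type) [Field k] [CharP k p] [IsAlgClosed k] (n : ℕ) (H : AlgebraicGeometry.Scheme.{0})
    (ι : H ⟶ (Literature.AlgebraicGeometry.Motives.projectiveSpace n k).left) :
    PermAt p k n H ι → ModelChainAt p k n H ι := by
  rintro ⟨O, i1, i2, i3, i4, π, hπ, h'⟩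
  refine ⟨O, i1, i2, i3, i4, π, hπ, ?_⟩
  letI := MvPolynomial.gradedAlgebra (σ := Fin (n + 1)) (R := O)
  letI := MvPolynomial.gradedAlgebra (σ := Fin (n + 1)) (R := k)
  intro φ hφ' hφ Y hY
  obtain ⟨P', σ, S', D', hch, hsm⟩ := h' φ hφ' hφ Y hY
  exact ⟨P', σ, S', D', fun Q hbase hstep => hch Q hbase
    (fun X' X'' σ' Y' D₁ C τ D'' hQ hbl hreg hfl hng hle _ hfl'' hfib => hstep X' X'' σ' Y' D₁ C τ D'' hQ hbl hreg hfl hng hle hfl'' hfib),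
    hsm⟩

/-- [OURS] **Non-vacuity: a SMOOTH lift gives `ModelChainAt` with the empty chain.** If over some characteristic-0 DVR `O ↠ k`, for
every `φ, Y` of the item there is an ideal sheaf `D₀` on `ℙⁿ_O` with `V(D₀)` flat and SMOOTH over `O` and special-fibre set `Y` (a smooth
lift of `H`), then `ModelChainAt p k n H ι` (stage `(ℙⁿ_O, 𝟙, Y, D₀)`, no blow-up). [folklore] -/
theorem modelChainAt_of_smoothLift (p : ℕ) (k : Type) [Field k] [CharP k p] [IsAlgClosed k] (n : ℕ) (H : AlgebraicGeometry.Scheme.{0})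
    (ι : H ⟶ (Literature.AlgebraicGeometry.Motives.projectiveSpace n k).left)
    (O : Type) [CommRing O] [IsDomain O] [IsDiscreteValuationRing O] [CharZero O] (π : O →+* k) (hπ : Function.Surjective π)
    (hlift : letI := MvPolynomial.gradedAlgebra (σ := Fin (n + 1)) (R := O);
      letI := MvPolynomial.gradedAlgebra (σ := Fin (n + 1)) (R := k);
      ∀ (φ : MvPolynomial.homogeneousSubmodule (Fin (n + 1)) O →+*ᵍ MvPolynomial.homogeneousSubmodule (Fin (n + 1)) k)
        (hφ' : HomogeneousIdeal.irrelevant (MvPolynomial.homogeneousSubmodule (Fin (n + 1)) k) ≤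
          (HomogeneousIdeal.irrelevant (MvPolynomial.homogeneousSubmodule (Fin (n + 1)) O)).map φ),
        (∀ s, φ s = MvPolynomial.map π s) →
        ∀ Y : Set (Proj (MvPolynomial.homogeneousSubmodule (Fin (n + 1)) O)),
          Y = Set.range (CategoryStruct.comp ι (Proj.map φ hφ') :
            H ⟶ Proj (MvPolynomial.homogeneousSubmodule (Fin (n + 1)) O)) →
          ∃ D₀ : (Proj (MvPolynomial.homogeneousSubmodule (Fin (n + 1)) O)).IdealSheafData,
            Flat (CategoryStruct.comp D₀.subschemeι
              (CategoryStruct.comp (Proj.toSpecZero (MvPolynomial.homogeneousSubmodule (Fin (n + 1)) O))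
              (Spec.map (CommRingCat.ofHom (algebraMap O (MvPolynomial.homogeneousSubmodule (Fin (n + 1)) O 0)))))) ∧
            (D₀.support : Set (Proj (MvPolynomial.homogeneousSubmodule (Fin (n + 1)) O))) ∩
                (CategoryStruct.comp (Proj.toSpecZero (MvPolynomial.homogeneousSubmodule (Fin (n + 1)) O))
              (Spec.map (CommRingCat.ofHom (algebraMap O (MvPolynomial.homogeneousSubmodule (Fin (n + 1)) O 0))))) ⁻¹'
                  {IsLocalRing.closedPoint O} = Y ∧
            Smooth (CategoryStruct.comp D₀.subschemeι
              (CategoryStruct.comp (Proj.toSpecZero (MvPolynomial.homogeneousSubmodule (Fin (n + 1)) O))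
              (Spec.map (CommRingCat.ofHom (algebraMap O (MvPolynomial.homogeneousSubmodule (Fin (n + 1)) O 0))))))) :
    ModelChainAt p k n H ι := by
  refine ⟨O, inferInstance, inferInstance, inferInstance, inferInstance, π, hπ, ?_⟩
  letI := MvPolynomial.gradedAlgebra (σ := Fin (n + 1)) (R := O)
  letI := MvPolynomial.gradedAlgebra (σ := Fin (n + 1)) (R := k)
  intro φ hφ' hφ Y hY
  obtain ⟨D₀, hflat, hfib, hsm⟩ := hlift φ hφ' hφ Y hY
  refine ⟨_, CategoryStruct.id _, Y, D₀, fun Q hbase _ => hbase D₀ hflat hfib, ?_⟩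
  simpa only [Category.id_comp] using hsm

/-! ## THE TRANSFER (strat-1's `PermTransfer`, with `SmoothModelEnd` discharged by `…NatSmoothModelEnd.smoothModelEnd`) -/


/-- [OURS] **`ModelChainAt ⟹ HorizAt`** for one hypersurface and EVERY `n`: the lifted-model chain is a horizontal E1 chain whose end has
regular reduced strict transform (`smoothModelEnd`). [folklore] -/
theorem horizAt_of_modelChainAt (p : ℕ) (k : Type) [Field k] [CharP k p] [IsAlgClosed k] (n : ℕ)
    (H : AlgebraicGeometry.Scheme.{0}) (ι : H ⟶ (Literature.AlgebraicGeometry.Motives.projectiveSpace n k).left) :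
    ModelChainAt p k n H ι → HorizAt p k n H ι := by
  classical
  intro h
  obtain ⟨O, i1, i2, i3, i4, π, hπ, h'⟩ := h
  refine ⟨O, i1, i2, i3, i4, π, hπ, ?_⟩
  letI := MvPolynomial.gradedAlgebra (σ := Fin (n + 1)) (R := O)
  letI := MvPolynomial.gradedAlgebra (σ := Fin (n + 1)) (R := k)
  intro φ hφ' hφ Y hY
  obtain ⟨P', σ, S', D', hch, hsm⟩ := h' φ hφ' hφ Y hY
  -- the invariant «special-fibre set of the model = strict-transform set»
  have hinv : (D'.support : Set P') ∩ (CategoryStruct.comp σ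
      (CategoryStruct.comp (Proj.toSpecZero (MvPolynomial.homogeneousSubmodule (Fin (n + 1)) O))
        (Spec.map (CommRingCat.ofHom (algebraMap O (MvPolynomial.homogeneousSubmodule (Fin (n + 1)) O 0)))))) ⁻¹'
        {IsLocalRing.closedPoint O} = S' := by
    refine hch (fun X' σ' Y' D' => (D'.support : Set X') ∩ (CategoryStruct.comp σ'
      (CategoryStruct.comp (Proj.toSpecZero (MvPolynomial.homogeneousSubmodule (Fin (n + 1)) O))
        (Spec.map (CommRingCat.ofHom (algebraMap O (MvPolynomial.homogeneousSubmodule (Fin (n + 1)) O 0)))))) ⁻¹'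
        {IsLocalRing.closedPoint O} = Y') ?_ ?_
    · intro D₀ _ hfib
      simpa using hfib
    · intro X' X'' σ' Y' D₁ C τ D'' _ _ _ _ _ _ _ hfib
      exact hfib
  refine ⟨P', σ, S', ?_, ?_⟩
  · intro Q hbase hstep
    have key := hch (fun X' σ' Y' D' => Q X' σ' Y' ∧ (D'.support : Set X') ∩ (CategoryStruct.comp σ'
      (CategoryStruct.comp (Proj.toSpecZero (MvPolynomial.homogeneousSubmodule (Fin (n + 1)) O))
        (Spec.map (CommRingCat.ofHom (algebraMap O (MvPolynomial.homogeneousSubmodule (Fin (n + 1)) O 0)))))) ⁻¹'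
        {IsLocalRing.closedPoint O} = Y') ?_ ?_
    · exact key.1
    · intro D₀ _ hfib
      exact ⟨hbase, by simpa using hfib⟩
    · intro X' X'' σ' Y' D₁ C τ D'' hQ hbl hreg hflatC hng hle _ hfib
      refine ⟨hstep X' X'' σ' Y' C τ hQ.1 hbl hreg hflatC hng ?_, hfib⟩
      intro x hx
      rw [← hQ.2]
      exact ⟨Scheme.IdealSheafData.support_antitone hle hx.1, hx.2⟩
  · have hcl : IsClosed S' := by
      rw [← hinv]
      exact D'.support.isClosed.inter ((IsLocalRing.isClosed_singleton_closedPoint O).preimage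
        (Scheme.Hom.continuous _))
    exact smoothModelEnd O P' _ S' D' hsm (by rw [hcl.closure_eq]; exact hinv)

/-- [OURS] `PermAt ⟹ HorizAt`, every `n`. [folklore] -/
theorem horizAt_of_permAt (p : ℕ) (k : Type) [Field k] [CharP k p] [IsAlgClosed k] (n : ℕ)
    (H : AlgebraicGeometry.Scheme.{0}) (ι : H ⟶ (Literature.AlgebraicGeometry.Motives.projectiveSpace n k).left) :
    PermAt p k n H ι → HorizAt p k n H ι :=
  fun h => horizAt_of_modelChainAt p k n H ι (modelChainAt_of_permAt p k n H ι h)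

/-- [OURS] **`ModelChainAt ⟹ ELNatAt`** (the crux's conclusion block at one hypersurface), EVERY `n` (`elNatAt_of_horizAt`, p508745).
[folklore] -/
theorem elNatAt_of_modelChainAt (p : ℕ) (k : Type) [Field k] [CharP k p] [IsAlgClosed k] (n : ℕ)
    (H : AlgebraicGeometry.Scheme.{0}) (ι : H ⟶ (Literature.AlgebraicGeometry.Motives.projectiveSpace n k).left)
    (hι : AlgebraicGeometry.IsClosedImmersion ι) (hH : AlgebraicGeometry.IsIntegral H) :
    ModelChainAt p k n H ι → ELNatAt p k n H ι :=
  fun h => elNatAt_of_horizAt p k n H ι hι hH (horizAt_of_modelChainAt p k n H ι h)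

/-- [OURS] `PermAt ⟹ ELNatAt`, every `n`. [folklore] -/
theorem elNatAt_of_permAt (p : ℕ) (k : Type) [Field k] [CharP k p] [IsAlgClosed k] (n : ℕ)
    (H : AlgebraicGeometry.Scheme.{0}) (ι : H ⟶ (Literature.AlgebraicGeometry.Motives.projectiveSpace n k).left)
    (hι : AlgebraicGeometry.IsClosedImmersion ι) (hH : AlgebraicGeometry.IsIntegral H) :
    PermAt p k n H ι → ELNatAt p k n H ι :=
  fun h => elNatAt_of_modelChainAt p k n H ι hι hH (modelChainAt_of_permAt p k n H ι h)

/-- [OURS · STRATEGIST] **THE TRANSFER AT `p`**: `PermELNat p → EquisingularLiftNat p` (`Theorems.EquisingularLiftNat`, the per-prime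
spelling of the crux; `equisingularLiftNat_iff_forall_elNatAt`). [folklore] -/
theorem equisingularLiftNat_of_permELNat (p : ℕ) :
    PermELNat p → Summit.ResolutionOfSingularities.ResolutionOfSingularities.Theorems.EquisingularLiftNat p := by
  intro hP
  rw [equisingularLiftNat_iff_forall_elNatAt]
  intro hp k _ _ _ n H ι hι hH hloc
  exact elNatAt_of_permAt p k n H ι hι hH (hP hp k n H ι hι hH hloc)

/-- [OURS · STRATEGIST] **THE TRANSFER HOLDS, UNCONDITIONALLY**: `(∀ p, PermELNat p) → EquisingularLiftNat` (the crux BY NAME). [folklore] -/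
theorem permTransfer :
    (∀ p : ℕ, PermELNat p) → Summit.ResolutionOfSingularities.ResolutionOfSingularities.Theses.EquisingularLift.EquisingularLiftNat := by
  intro hP p hp k _ _ _ n H ι hι hH hloc
  exact elNatAt_of_permAt p k n H ι hι hH (hP p hp k n H ι hι hH hloc)

end Summit.ResolutionOfSingularities.ResolutionOfSingularities.Cruxes.EquisingularLiftNat.PermFrame

end
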